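import Summits.SmoothPoincare4.SmoothPoincare4.Theorems.VerlindeRLinksVrlComponentsHBallSliceReduction
import Literature.Topology.FourManifolds.ZeroSphereSurgeryConnectedSum
import HarnessLib

/-!
# Crux `VerlindeRLinks.VrlComponentsHBallSlice` (stmt-SmoothPoincare4-15874), line `kirby-lemma21`:
# every component of an R-link is slice in a homotopy `4`-ball — final assembly

The crux `Summit.SmoothPoincare4.SmoothPoincare4.Theses.VerlindeRLinks.VrlComponentsHBallSlice`
(Gompf–Scharlemann–Thompson 2010, Prop. 2.3 (Hillman), componentwise: every component of a framed
link `L ⊂ S³` whose surgery is `#ⁿ(S² × S¹)` is slice in a homotopy `4`-ball) follows from the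
sorry-free composition of the line (`…Reduction.lean`, `helper_crux_of_zeroSphereSurgery`: the crux from
the four landed stubs modulo the `S⁰`-surgery lemma — via Kirby's sentence
`∂(♮ⁿ S¹ × B³) = #ⁿ(S² × S¹)` (`OneHandlebodyBoundarySum.lean`, UNIQ₄ induction along one-handle
attachments) and the boundary of a one-handle attachment as a `0`-surgery along a framed `S⁰`
(`OneHandleAttachmentBoundarySurgery.lean`, `OneHandlebodyBoundarySumProofs.lean`)) and the now PROVED
`S⁰`-surgery lemma `FramedSphereFamily.isConnectedSum_sphereTwoProdCircle_of_isSurgery_of_isOrientable`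
(`ZeroSphereSurgeryConnectedSum.lean`: `0`-surgery along a framed `S⁰` in a connected `3`-manifold
with orientable result is `· # (S² × S¹)`; model `S² × S¹ ∖ pt`, standard discs, neck assembly,
disc-theorem normalisation and non-orientability of the twisted position).

## References

* R. E. Gompf, M. Scharlemann, A. Thompson, Geom. Topol. 14 (2010) 2305–2347, Prop. 2.3, §9.
  [GompfScharlemannThompson2010]
* R. C. Kirby, *The Topology of 4-Manifolds*, LNM 1374 (1989), Ch. I §2 (p. 8), Lemma 2.1. [Kirby1989]
* A. A. Kosinski, *Differential Manifolds* (1993), VI §6, §9. [Kosinski1993]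
-/

-- `Summit.<Summit>.<Problem>`: single-conjunct summit, the duplicate component is mandated (CONVENTIONS §2).
set_option linter.dupNamespace false

noncomputable section

namespace Summit.SmoothPoincare4.SmoothPoincare4.Theorems.VrlComponentsHBallSlice.KirbyLemma21

open Literature.Topology.FourManifolds

/-- **Every component of an R-link is slice in a homotopy `4`-ball** (the crux
`VerlindeRLinks.VrlComponentsHBallSlice`, Gompf–Scharlemann–Thompson 2010, Prop. 2.3): the
composition of line `kirby-lemma21` (`helper_crux_of_zeroSphereSurgery`) applied to the `S⁰`-surgery
lemma `FramedSphereFamily.isConnectedSum_sphereTwoProdCircle_of_isSurgery_of_isOrientable`.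
[GompfScharlemannThompson2010, Prop. 2.3] [Kirby1989, Ch. I §2 (p. 8)] [Kosinski1993, VI §9] -/
theorem VrlComponentsHBallSlice_proof :
    Summit.SmoothPoincare4.SmoothPoincare4.Theses.VerlindeRLinks.VrlComponentsHBallSlice :=
  helper_crux_of_zeroSphereSurgery fun _ _ _ _ _ _ νS _ _ _ _ _ hS ho =>
    νS.isConnectedSum_sphereTwoProdCircle_of_isSurgery_of_isOrientable hS ho

end Summit.SmoothPoincare4.SmoothPoincare4.Theorems.VrlComponentsHBallSlice.KirbyLemma21

end
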